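import Summits.HubbardSuperconductivity.HubbardSuperconductivity.Theses.ThermalWedge
import Summits.HubbardSuperconductivity.HubbardSuperconductivity.Theorems.ThermalWedgeTwSeededEnsembleEquivalenceRColdRegularityOfParts

/-!
# Crux `TwSeededEnsembleEquivalenceR` (stmt-HubbardSuperconductivity-15581), line `cold-floor-collapse`
# (slug `Sketch`) — FLOOR `stub_optimiserFloor`: at the cold slice every AHM maximiser is a deep source

Support file (`--supports stmt-HubbardSuperconductivity-15581`; sorry-free; no definition).
Glue over the route item `TwSourcedCondensation` (stmt-HubbardSuperconductivity-1697, taken as a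
HYPOTHESIS): on every compact window `[μ₁, μ₂] ⊂ (−4, 0)`, with 1697's constants `U₀ᶜ, a₂, c, C, h₀`,
for every exponent `a ∈ (0, a₂]`, seed floor `K' := 24/(c a)` and `U ≤ U₀(a)` small: if `q μ h` is the
pointwise thermodynamic limit of the SOURCED torus pressure
`p̃_L(β, μ, h) = log Re Z(β, dWaveSourceTorus L U μ h)/(β L²)` at the cold slice `β = e^{a/U}` on the box
`[μ₁, μ₂] × [−(13g+1), 13g+1]`, then every maximiser `h` of the AHM functional `h' ↦ q μ h' − h'²/g` over
`|h'| ≤ 13g+1` satisfies `e^{−a/(4U)} ≤ |h|`.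

Mechanism (real analysis, all constants explicit): at the one regulated source `h₁ := e^{−a/(12U)}`
(`≤ h₀`, in the box) 1697 passes to the limit as
`q μ h₁ − q μ 0 ≥ c h₁² log(1/(h₁ + e^{−a/U})) − C h₁² ≥ h₁² (c a/(12U) − c log 2 − C)`, and
`1/g ≤ 1/(K'U) = c a/(24U)`, so the maximal AHM gain over `h = 0` is `≥ h₁²·c a/(48U)` once
`U ≤ c a/(48(c log 2 + C))`; the `h`-Lipschitz bound `cfc_abs_sourcedPressure_sub_h_le` (constant `C_d`,
inherited by the limit) caps the gain of any source `h` by `C_d |h|`; finally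
`e^{−a/(6U)}·c a/(48U) ≥ (C_d+1)·e^{−a/(4U)}` for `U ≤ min 1 (c a²/(576 (C_d+1)))` because
`e^{a/(12U)} ≥ a/(12U)`. [folklore real analysis over the BenfattoGiulianiMastropietro2006-class input 1697]
-/

set_option linter.dupNamespace false

namespace Summit.HubbardSuperconductivity.HubbardSuperconductivity.Theorems.TwSeededEnsembleEquivalenceR.ColdFloorLine

open Matrix Filter Topology Finset Literature.MathematicalPhysics.QuantumLattice
open Summit.HubbardSuperconductivity.HubbardSuperconductivity.Theses.ThermalWedge
open scoped ComplexOrder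

noncomputable section

/-! ### Real-analysis helpers -/

/-- One-sided bounds holding EVENTUALLY pass to pointwise limits: if `uₙ → A`, `vₙ → B` (`ε`–`N` form)
and `uₙ ≤ vₙ` for all large `n`, then `A ≤ B` (eventually-variant of `cfb_le_of_limits`). [folklore] -/
theorem flr_le_of_limits_ev {u v : ℕ → ℝ} {A B : ℝ}
    (hu : ∀ κ : ℝ, 0 < κ → ∃ N : ℕ, ∀ n, N ≤ n → |u n - A| ≤ κ)
    (hv : ∀ κ : ℝ, 0 < κ → ∃ N : ℕ, ∀ n, N ≤ n → |v n - B| ≤ κ)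
    (huv : ∃ N : ℕ, ∀ n, N ≤ n → u n ≤ v n) : A ≤ B := by
  apply le_of_forall_pos_lt_add
  intro ε hε
  obtain ⟨N₁, hN₁⟩ := hu (ε / 4) (by positivity)
  obtain ⟨N₂, hN₂⟩ := hv (ε / 4) (by positivity)
  obtain ⟨N₃, hN₃⟩ := huv
  have h1 := hN₁ (max N₁ (max N₂ N₃)) (le_max_left _ _)
  have h2 := hN₂ (max N₁ (max N₂ N₃)) ((le_max_left _ _).trans (le_max_right _ _))
  have h3 := hN₃ (max N₁ (max N₂ N₃)) ((le_max_right _ _).trans (le_max_right _ _))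
  rw [abs_le] at h1 h2
  linarith

/-- `(e^{−a/(12U)})² = e^{−a/(6U)}`. [folklore] -/
theorem flr_h1_sq (a U : ℝ) : Real.exp (-(a / (12 * U))) ^ 2 = Real.exp (-(a / (6 * U))) := by
  rw [sq, ← Real.exp_add]
  congr 1
  ring

/-- The Cooper logarithm at the regulated source `h₁ = e^{−a/(12U)}` and temperature `e^{−a/U} ≤ h₁`:
`log(1/(h₁ + e^{−a/U})) ≥ log(1/(2h₁)) = a/(12U) − log 2`. [folklore] -/
theorem flr_log_lower {a U : ℝ} (hU : 0 < U) (ha : 0 < a) :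
    a / (12 * U) - Real.log 2 ≤
      Real.log (1 / (Real.exp (-(a / (12 * U))) + 1 / Real.exp (a / U))) := by
  have h1 : (1 : ℝ) / Real.exp (a / U) = Real.exp (-(a / U)) := by
    rw [Real.exp_neg, one_div]
  have hq : a / (12 * U) ≤ a / U := by
    rw [div_le_div_iff₀ (by positivity) hU]
    nlinarith
  have hle : Real.exp (-(a / U)) ≤ Real.exp (-(a / (12 * U))) := Real.exp_le_exp.2 (by linarith)
  have hpos : 0 < Real.exp (-(a / (12 * U))) + Real.exp (-(a / U)) := by positivity
  rw [h1, one_div, Real.log_inv]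
  have hx : Real.exp (-(a / (12 * U))) + Real.exp (-(a / U)) ≤ 2 * Real.exp (-(a / (12 * U))) := by
    linarith
  have hlog : Real.log (Real.exp (-(a / (12 * U))) + Real.exp (-(a / U))) ≤
      Real.log (2 * Real.exp (-(a / (12 * U)))) := Real.log_le_log hpos hx
  rw [Real.log_mul (by norm_num) (Real.exp_pos _).ne', Real.log_exp] at hlog
  linarith

/-- The final comparison of scales: for `0 < U ≤ min 1 (c a²/(576 D))`,
`D · e^{−a/(4U)} ≤ e^{−a/(6U)} · (c a/(48U))`, via `e^{−a/(6U)} = e^{−a/(4U)} e^{a/(12U)}` and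
`e^{a/(12U)} ≥ a/(12U)`. [folklore] -/
theorem flr_final_compare {a U c D : ℝ} (hU : 0 < U) (ha : 0 < a) (hc : 0 < c) (hD : 0 < D)
    (hU1 : U ≤ 1) (hU2 : U ≤ c * a ^ 2 / (576 * D)) :
    D * Real.exp (-(a / (4 * U))) ≤ Real.exp (-(a / (6 * U))) * (c * a / (48 * U)) := by
  have hsplit : Real.exp (-(a / (6 * U))) = Real.exp (-(a / (4 * U))) * Real.exp (a / (12 * U)) := by
    rw [← Real.exp_add]
    congr 1
    field_simp
    ring
  rw [hsplit]
  have hE : a / (12 * U) ≤ Real.exp (a / (12 * U)) := by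
    have := Real.add_one_le_exp (a / (12 * U))
    linarith
  have hpos := Real.exp_pos (-(a / (4 * U)))
  have h576 : 576 * D * U ≤ c * a ^ 2 := by
    have := (le_div_iff₀ (by positivity : (0 : ℝ) < 576 * D)).1 hU2
    linarith
  have hUU : U ^ 2 ≤ U := by nlinarith
  have key : D ≤ a / (12 * U) * (c * a / (48 * U)) := by
    rw [div_mul_div_comm, le_div_iff₀ (by positivity)]
    nlinarith [mul_le_mul_of_nonneg_left hUU (by positivity : (0 : ℝ) ≤ 576 * D), h576]
  have key2 : D ≤ Real.exp (a / (12 * U)) * (c * a / (48 * U)) :=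
    key.trans (mul_le_mul_of_nonneg_right hE (by positivity))
  calc D * Real.exp (-(a / (4 * U))) = Real.exp (-(a / (4 * U))) * D := by ring
    _ ≤ Real.exp (-(a / (4 * U))) * (Real.exp (a / (12 * U)) * (c * a / (48 * U))) :=
        mul_le_mul_of_nonneg_left key2 hpos.le
    _ = Real.exp (-(a / (4 * U))) * Real.exp (a / (12 * U)) * (c * a / (48 * U)) := by ring

/-! ### FLOOR -/

/-- **FLOOR (glue over route item stmt-1697): at the cold slice every maximiser of the AHM functional is
a DEEP source.** From `TwSourcedCondensation` (constants `U₀ᶜ, a₂, c, C, h₀` on the window): for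
`a ≤ a₂`, `K' := 24/(c·a)` and `U ≤ U₀(a)` small, if `q` is the pointwise limit of the sourced torus
pressure at `β = e^{a/U}` on `[μ₁,μ₂] × [−(13g+1), 13g+1]`, then every maximiser `h` of
`h' ↦ q μ h' − h'²/g` over the box has `e^{−a/(4U)} ≤ |h|`. Mechanism: at `h₁ := e^{−a/(12U)}` (`≤ h₀`, in
the box) 1697 passes to the limit as `q μ h₁ − q μ 0 ≥ c h₁² log(1/(h₁ + e^{−a/U})) − C h₁² ≥
h₁²(c a/(12U) − c log 2 − C)`, and `1/g ≤ 1/(K'U) = c a/(24U)`, so the maximal gain is `≥ h₁²·c a/(48U)`;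
the `h`-Lipschitz bound (`cfc_abs_sourcedPressure_sub_h_le`, constant `C_d`, in the limit) gives gain
`≤ C_d |h| ≤ (C_d+1)|h|`; and `e^{−a/(6U)}·c a/(48U) ≥ (C_d+1) e^{−a/(4U)}` for small `U`.
[folklore real analysis over BenfattoGiulianiMastropietro2006-class input 1697] -/
theorem stub_optimiserFloor :
    TwSourcedCondensation →
    ∀ (μ₁ μ₂ : ℝ), -4 < μ₁ → μ₁ < μ₂ → μ₂ < 0 → ∃ a₂ : ℝ, 0 < a₂ ∧ ∀ a ∈ Set.Ioc (0 : ℝ) a₂,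
      ∃ K' U₀ : ℝ, 0 < K' ∧ 0 < U₀ ∧ ∀ U ∈ Set.Ioc (0 : ℝ) U₀, ∀ g ∈ Set.Icc (K' * U) (1 / 10),
        ∀ q : ℝ → ℝ → ℝ,
          (∀ μ ∈ Set.Icc μ₁ μ₂, ∀ h ∈ Set.Icc (-(13 * g + 1)) (13 * g + 1), ∀ κ : ℝ, 0 < κ →
            ∃ L₀ : ℕ, ∀ (L : ℕ) [NeZero L], L₀ ≤ L →
              |Real.log (Matrix.partitionFn (Real.exp (a / U)) (dWaveSourceTorus L U μ h)).re /
                  (Real.exp (a / U) * (L : ℝ) ^ 2) - q μ h| ≤ κ) →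
          ∀ μ ∈ Set.Icc μ₁ μ₂, ∀ h ∈ Set.Icc (-(13 * g + 1)) (13 * g + 1),
            q μ h - h ^ 2 / g =
                sSup ((fun h' : ℝ => q μ h' - h' ^ 2 / g) '' Set.Icc (-(13 * g + 1)) (13 * g + 1)) →
              Real.exp (-(a / (4 * U))) ≤ |h| := by
  intro hC μ₁ μ₂ hμ₁ hμ₁₂ hμ₂
  obtain ⟨U₀c, a₂, c, C, h₀, hU₀c, ha₂, hc, hCpos, hh₀, hcond⟩ := hC μ₁ μ₂ hμ₁ hμ₁₂.le hμ₂
  -- the `L`-independent `h`-Lipschitz constant `C_d` of the sourced pressure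
  obtain ⟨Cd, hCd0, hLip⟩ : ∃ Cd : ℝ, 0 ≤ Cd ∧ ∀ (L : ℕ) [NeZero L] (U μ : ℝ) {β : ℝ}, 0 < β →
      ∀ h h' : ℝ, |Real.log (partitionFn β (dWaveSourceTorus L U μ h)).re / (β * (L : ℝ) ^ 2) -
        Real.log (partitionFn β (dWaveSourceTorus L U μ h')).re / (β * (L : ℝ) ^ 2)| ≤ Cd * |h - h'| :=
    ⟨_, by positivity, fun L _ U μ β hβ h h' => cfc_abs_sourcedPressure_sub_h_le L U μ hβ h h'⟩
  refine ⟨a₂, ha₂, fun a ha => ?_⟩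
  have ha0 : 0 < a := ha.1
  have hD : 0 < Cd + 1 := by linarith
  have hlog2 : 0 < Real.log 2 := Real.log_pos (by norm_num)
  have hM : 0 < c * Real.log 2 + C := by
    have := mul_pos hc hlog2
    linarith
  have hK'pos : 0 < 24 / (c * a) := by positivity
  have hU₀pos : 0 < min U₀c (min 1 (min (c * a / (48 * (c * Real.log 2 + C)))
      (min (c * a ^ 2 / (576 * (Cd + 1))) (a / (12 * (|Real.log h₀| + 1)))))) :=
    lt_min hU₀c (lt_min one_pos (lt_min (div_pos (mul_pos hc ha0) (mul_pos (by norm_num) hM))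
      (lt_min (by positivity) (by positivity))))
  refine ⟨24 / (c * a), _, hK'pos, hU₀pos, fun U hU g hg q hq μ hμ h hh hmax => ?_⟩
  -- the smallness conditions on `U`
  have hUpos : 0 < U := hU.1
  have hUU₀c : U ≤ U₀c := hU.2.trans (min_le_left _ _)
  have hU1 : U ≤ 1 := hU.2.trans ((min_le_right _ _).trans (min_le_left _ _))
  have hU3 : U ≤ c * a / (48 * (c * Real.log 2 + C)) :=
    hU.2.trans ((min_le_right _ _).trans ((min_le_right _ _).trans (min_le_left _ _)))
  have hU4 : U ≤ c * a ^ 2 / (576 * (Cd + 1)) :=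
    hU.2.trans ((min_le_right _ _).trans ((min_le_right _ _).trans
      ((min_le_right _ _).trans (min_le_left _ _))))
  have hU5 : U ≤ a / (12 * (|Real.log h₀| + 1)) :=
    hU.2.trans ((min_le_right _ _).trans ((min_le_right _ _).trans
      ((min_le_right _ _).trans (min_le_right _ _))))
  have hg0 : 0 < g := lt_of_lt_of_le (mul_pos hK'pos hUpos) hg.1
  -- the box
  set H : ℝ := 13 * g + 1 with hHdef
  have hH1 : 1 ≤ H := by rw [hHdef]; linarith [hg0.le]
  -- the cold slice
  set β : ℝ := Real.exp (a / U) with hβdef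
  have hβ : 0 < β := Real.exp_pos _
  have hβ1 : 1 ≤ β := Real.one_le_exp (div_nonneg ha0.le hUpos.le)
  have hβa₂ : β ≤ Real.exp (a₂ / U) := Real.exp_le_exp.2 (div_le_div_of_nonneg_right ha.2 hUpos.le)
  -- the regulated source `h₁`
  set h₁ : ℝ := Real.exp (-(a / (12 * U))) with hh₁def
  have hh₁pos : 0 < h₁ := Real.exp_pos _
  have hh₁le1 : h₁ ≤ 1 := Real.exp_le_one_iff.2 (by
    have : 0 ≤ a / (12 * U) := by positivity
    linarith)
  have hh₁box : h₁ ∈ Set.Icc (-H) H := ⟨by linarith, by linarith⟩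
  have h0box : (0 : ℝ) ∈ Set.Icc (-H) H := ⟨by linarith, by linarith⟩
  have hh₁h₀ : h₁ ≤ h₀ := by
    have h1 : |Real.log h₀| + 1 ≤ a / (12 * U) := by
      rw [le_div_iff₀ (by positivity)]
      have := (le_div_iff₀ (by positivity : (0 : ℝ) < 12 * (|Real.log h₀| + 1))).1 hU5
      linarith
    have h2 : -(a / (12 * U)) ≤ Real.log h₀ := by
      have := neg_abs_le (Real.log h₀)
      linarith
    calc h₁ = Real.exp (-(a / (12 * U))) := rfl
      _ ≤ Real.exp (Real.log h₀) := Real.exp_le_exp.2 h2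
      _ = h₀ := Real.exp_log hh₀
  have hh₁abs : |h₁| ≤ h₀ := by rw [abs_of_pos hh₁pos]; exact hh₁h₀
  -- the sequences `n ↦ p̃_{n+1}(h')` converge to `q μ h'` on the box
  have hseq : ∀ h' ∈ Set.Icc (-H) H, ∀ κ : ℝ, 0 < κ → ∃ N : ℕ, ∀ n, N ≤ n →
      |Real.log (partitionFn β (dWaveSourceTorus (n + 1) U μ h')).re / (β * (((n + 1 : ℕ) : ℝ)) ^ 2) -
        q μ h'| ≤ κ := by
    intro h' hh' κ hκ
    obtain ⟨L₀, hL₀⟩ := hq μ hμ h' hh' κ hκ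
    exact ⟨L₀, fun n hn => hL₀ (n + 1) (by omega)⟩
  -- (iii) `h`-Lipschitz bound in the limit
  have hLh : ∀ h' ∈ Set.Icc (-H) H, ∀ h'' ∈ Set.Icc (-H) H, |q μ h' - q μ h''| ≤ Cd * |h' - h''| := by
    intro h' hh' h'' hh''
    refine cfb_abs_sub_le_of_limits (hseq h' hh') (hseq h'' hh'') fun n => ?_
    exact hLip (n + 1) U μ hβ h' h''
  -- (ii) 1697 in the limit at the regulated source `h₁`
  obtain ⟨L₁, hL₁⟩ := hcond U hUpos hUU₀c β hβ1 hβa₂ μ hμ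
  set D : ℝ := c * h₁ ^ 2 * Real.log (1 / (|h₁| + 1 / β)) - C * h₁ ^ 2 with hDdef
  have hgain : D + q μ 0 ≤ q μ h₁ := by
    refine flr_le_of_limits_ev
      (u := fun n => D + Real.log (partitionFn β (dWaveSourceTorus (n + 1) U μ 0)).re /
        (β * (((n + 1 : ℕ) : ℝ)) ^ 2))
      (v := fun n => Real.log (partitionFn β (dWaveSourceTorus (n + 1) U μ h₁)).re /
        (β * (((n + 1 : ℕ) : ℝ)) ^ 2))
      ?_ (hseq h₁ hh₁box) ⟨L₁, fun n hn => ?_⟩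
    · intro κ hκ
      obtain ⟨N, hN⟩ := hseq 0 h0box κ hκ
      refine ⟨N, fun n hn => ?_⟩
      rw [add_sub_add_left_eq_sub]
      exact hN n hn
    · have := hL₁ (n + 1) (by omega) h₁ hh₁abs
      linarith
  -- (iv) the maximum dominates the value at `h₁`
  have hbdd : BddAbove ((fun h' : ℝ => q μ h' - h' ^ 2 / g) '' Set.Icc (-H) H) := by
    refine ⟨q μ 0 + Cd * H, ?_⟩
    rintro _ ⟨h', hh', rfl⟩
    have h1 := hLh h' hh' 0 h0box
    rw [sub_zero] at h1
    have h2 : |h'| ≤ H := abs_le.2 hh'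
    have h3 : 0 ≤ h' ^ 2 / g := by positivity
    have h4 := (abs_le.1 h1).2
    have h5 : Cd * |h'| ≤ Cd * H := mul_le_mul_of_nonneg_left h2 hCd0
    show q μ h' - h' ^ 2 / g ≤ q μ 0 + Cd * H
    linarith
  have hval : q μ h₁ - h₁ ^ 2 / g ≤ q μ h - h ^ 2 / g := by
    rw [hmax]
    exact le_csSup hbdd ⟨h₁, hh₁box, rfl⟩
  -- (v) the chain of inequalities
  have hlip := hLh h hh 0 h0box
  rw [sub_zero] at hlip
  have hgainh : q μ h - q μ 0 ≤ Cd * |h| := (abs_le.1 hlip).2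
  have hsq : 0 ≤ h ^ 2 / g := by positivity
  -- arithmetic: `D − h₁²/g ≥ h₁² · c a/(48U)`
  have hlog : a / (12 * U) - Real.log 2 ≤ Real.log (1 / (h₁ + 1 / β)) := flr_log_lower hUpos ha0
  have hD' : c * h₁ ^ 2 * (a / (12 * U) - Real.log 2) - C * h₁ ^ 2 ≤ D := by
    rw [hDdef, abs_of_pos hh₁pos]
    have h0 : 0 ≤ c * h₁ ^ 2 := by positivity
    have := mul_le_mul_of_nonneg_left hlog h0
    linarith
  have hginv : h₁ ^ 2 / g ≤ h₁ ^ 2 * (c * a / (24 * U)) := by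
    rw [div_eq_mul_inv]
    refine mul_le_mul_of_nonneg_left ?_ (sq_nonneg _)
    rw [inv_le_comm₀ hg0 (by positivity)]
    calc (c * a / (24 * U))⁻¹ = 24 / (c * a) * U := by
          rw [inv_div]
          field_simp
      _ ≤ g := hg.1
  have hUsmall : c * Real.log 2 + C ≤ c * a / (48 * U) := by
    rw [le_div_iff₀ (by positivity)]
    have := (le_div_iff₀ (by positivity : (0 : ℝ) < 48 * (c * Real.log 2 + C))).1 hU3
    linarith
  have hcomb : h₁ ^ 2 * (c * a / (48 * U)) ≤ D - h₁ ^ 2 / g := by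
    have e1 : c * h₁ ^ 2 * (a / (12 * U) - Real.log 2) - C * h₁ ^ 2 - h₁ ^ 2 * (c * a / (24 * U))
        = h₁ ^ 2 * (c * a / (24 * U) - (c * Real.log 2 + C)) := by
      field_simp
      ring
    have e2 : h₁ ^ 2 * (c * a / (48 * U)) ≤ h₁ ^ 2 * (c * a / (24 * U) - (c * Real.log 2 + C)) := by
      refine mul_le_mul_of_nonneg_left ?_ (sq_nonneg _)
      have : c * a / (24 * U) = c * a / (48 * U) + c * a / (48 * U) := by
        field_simp
        ring
      linarith
    linarith
  -- the comparison of scales and the conclusion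
  have hh₁sq : h₁ ^ 2 = Real.exp (-(a / (6 * U))) := flr_h1_sq a U
  have hfinal : (Cd + 1) * Real.exp (-(a / (4 * U))) ≤ h₁ ^ 2 * (c * a / (48 * U)) := by
    rw [hh₁sq]
    exact flr_final_compare hUpos ha0 hc hD hU1 hU4
  have habs : 0 ≤ |h| := abs_nonneg h
  have hchain : (Cd + 1) * Real.exp (-(a / (4 * U))) ≤ (Cd + 1) * |h| := by
    nlinarith [hfinal, hcomb, hgain, hval, hgainh, hsq, habs, hCd0]
  exact le_of_mul_le_mul_left hchain hD

end

end Summit.HubbardSuperconductivity.HubbardSuperconductivity.Theorems.TwSeededEnsembleEquivalenceR.ColdFloorLine
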